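import Literature.NumberTheory.EllipticCurves.CuspFormRankinSelbergCoefficients
import Literature.NumberTheory.EllipticCurves.HeckeIntegralityProofs
import Literature.NumberTheory.Automorphic.HyperbolicDirichletForm
import HarnessLib

/-!
# The conjugated Rankin–Selberg trace `G_f^{(t)} = Σ_{A ∈ SL₂(ℤ)/Γ^{(t)}} |f|²y² ∘ D_t ∘ A⁻¹`
# of a cusp form on `Γ₀(N)` and its horocycle coefficients

Topic `NumberTheory/EllipticCurves` (modular forms on `Γ₀(N)`); namespace
`Literature.NumberTheory.EllipticCurves.ModularForms`. Companion of `CuspFormRankinSelbergTrace` /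
`CuspFormRankinSelbergCoefficients` (the `SL₂(ℤ)`-trace `rsTrace` of the Petersson density
`F_f = |f|²yᵏ` and its horocycle identity), which it generalises in two directions needed for the
Rankin–Selberg integral of `f ∈ S₂(Γ₀(N))` against the level-ONE Eisenstein series at the SCALED
points `E(tz, s)`, `t ∣ N` (the decomposition of the Eisenstein series of the cusp `∞` of `Γ₀(N)`,
`Gamma0EisensteinMoebius.moebiusWeight_mul_levelEisensteinG_eq_sum`):

1. **The trace from any finite-index subgroup.** For `Γ' ≤ SL₂(ℤ)` of finite index and a
   `Γ'`-invariant `Φ : ℍ → ℝ`, `invTrace Γ' Φ = Σ_{A ∈ SL₂(ℤ)/Γ'} Φ ∘ A⁻¹` is `SL₂(ℤ)`-invariant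
   (`invTrace_smul`), `≥ Φ ≥ 0`, continuous and bounded when `Φ` is (`le_invTrace`,
   `continuous_invTrace`, `invTrace_le`) — the proofs of `CuspFormRankinSelbergTrace` verbatim.
2. **The conjugated density.** For `t ≥ 1` let `D_t = diag(1, t)` (`scaleGL t`, acting by
   `w ↦ w/t`) and `Γ^{(t)} = SL₂(ℤ) ∩ D_t⁻¹Γ₀(N)D_t` (Mathlib `CongruenceSubgroup.conjGL`; a congruence
   subgroup, `= {γ : t ∣ b, N/t ∣ c}` when `t ∣ N`). The function `Φ_t(w) = F_f(w/t)` (`scaledDensity`)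
   is `Γ^{(t)}`-invariant (`scaledDensity_smul_of_mem`), and its trace
   `conjTrace N t f = G_f^{(t)}` is an `SL₂(ℤ)`-invariant continuous function with
   `0 ≤ G_f^{(t)} ≤ B` (`conjTrace_smul`, `continuous_conjTrace`, `exists_conjTrace_le`).
3. **The horocycle identity.** With the coefficients
   `conjCoeff N t f n = t⁻² Σ_{A} |cₙ(f |₂ A⁻¹)|²` (period-`N` `q`-expansion coefficients of the
   translates over representatives of `SL₂(ℤ)/Γ^{(t)}`; `≥ 0`, `= 0` at `n = 0`):
   **`∫₀¹ G_f^{(t)}(x + iy) dx = y² Σₙ conjCoeff(n) e^{−4πny/(Nt)}`** (`intervalIntegral_conjTrace_horizontal`):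
   the translate through `A` contributes `∫₀^{Nt} |(f|A⁻¹)((x+iy)/t)|² (y/t)² dx`, the substitution
   `x = tu` and Parseval for the period-`N` cusp function `f |₂ A⁻¹` at height `y/t`
   (`IsCuspFunction.integral_norm_sq_horizontal`). Hence the bound
   `Σₙ conjCoeff(n) e^{−4πny/(Nt)} ≤ B y⁻²` (`tsum_conjCoeff_mul_exp_le`).

So `(G_f^{(t)}, conjCoeff, a = 4π/(Nt), κ = 2, B)` is a horocycle datum in the sense of
`Literature.NumberTheory.Automorphic.RankinSelbergHorocycleMellin` / `RankinSelbergContinuationSL2`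
(`conjTrace_horocycle_datum` collects the hypotheses in that exact form), to which the entire
function `J₀` and the unfolding against `E(·, s)` of those files apply. The point (next file):
`∫_𝒟 G_f^{(t)} E(·, s) dμ = ∫_{Γ₀(N)∖ℍ} F_f(z) E(tz, s) dμ(z)`.

## References

* R. A. Rankin, Proc. Cambridge Philos. Soc. 35 (1939), 357–372, §4 (the trace device and (4.2.3)).
* H. Iwaniec, *Spectral Methods of Automorphic Forms*, GSM 53 (2002), §3.2, §7.1; §2.4 (`Γ₀(N)`).
* F. Diamond, J. Shurman, GTM 228, §5.4 (Petersson integrals over coset representatives).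

## Mathlib / tree search

Mathlib: `CongruenceSubgroup.conjGL`, `mem_conjGL`, `IsCongruenceSubgroup.conjGL`,
`IsCongruenceSubgroup.finiteIndex`, `Matrix.GeneralLinearGroup.mkOfDetNeZero`,
`intervalIntegral.integral_comp_div`. Tree: `petDensity`, `petDensity_slash`,
`petDensity_smul_of_mem`, `rsTrace` (pattern), `isCuspFunction_slash`,
`IsCuspFunction.integral_norm_sq_horizontal`, `intervalIntegral_zero_nat_of_periodic`, `pt`.
-/

noncomputable section

open ModularForm CongruenceSubgroup Complex Filter
open UpperHalfPlane hiding I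
open scoped MatrixGroups ModularForm Topology

namespace Literature.NumberTheory.EllipticCurves.ModularForms

open MeasureTheory Set intervalIntegral Literature.NumberTheory.Automorphic

/-! ### 1. The trace from a finite-index subgroup -/

section Trace

variable (Γ' : Subgroup SL(2, ℤ))

/-- **The `SL₂(ℤ)`-trace** of a function `Φ : ℍ → ℝ` from `Γ'`:
`Σ_{A Γ' ∈ SL₂(ℤ)/Γ'} Φ(A⁻¹ τ)` (through `Quotient.out`; independent of the representatives when
`Φ` is `Γ'`-invariant). [cite: Rankin1939, §4] -/
def invTrace (Φ : ℍ → ℝ) (τ : ℍ) : ℝ :=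
  ∑ᶠ q : SL(2, ℤ) ⧸ Γ', Φ ((Quotient.out q)⁻¹ • τ)

variable {Γ'}
variable {Φ : ℍ → ℝ}

/-- Independence of the representative for a `Γ'`-invariant `Φ`. [folklore] -/
theorem apply_out_inv_smul (hΦ : ∀ γ ∈ Γ', ∀ τ : ℍ, Φ (γ • τ) = Φ τ) (g : SL(2, ℤ)) (τ : ℍ) :
    Φ ((Quotient.out (QuotientGroup.mk g : SL(2, ℤ) ⧸ Γ'))⁻¹ • τ) = Φ (g⁻¹ • τ) := by
  obtain ⟨h, hh⟩ := QuotientGroup.mk_out_eq_mul Γ' g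
  rw [hh, mul_inv_rev, mul_smul]
  exact hΦ _ (inv_mem h.2) _

/-- The trace as a finite sum. [folklore] -/
theorem invTrace_eq_sum [Fintype (SL(2, ℤ) ⧸ Γ')] (Φ : ℍ → ℝ) (τ : ℍ) :
    invTrace Γ' Φ τ = ∑ q : SL(2, ℤ) ⧸ Γ', Φ ((Quotient.out q)⁻¹ • τ) := by
  unfold invTrace
  exact finsum_eq_sum_of_fintype _

/-- The trace of a non-negative function is non-negative. [folklore] -/
theorem invTrace_nonneg (hΦ0 : ∀ τ, 0 ≤ Φ τ) (τ : ℍ) : 0 ≤ invTrace Γ' Φ τ :=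
  finsum_nonneg fun _ ↦ hΦ0 _

variable [Γ'.FiniteIndex]

/-- **`SL₂(ℤ)`-invariance of the trace** of a `Γ'`-invariant function. [cite: Rankin1939, §4] -/
theorem invTrace_smul (hΦ : ∀ γ ∈ Γ', ∀ τ : ℍ, Φ (γ • τ) = Φ τ) (A : SL(2, ℤ)) (τ : ℍ) :
    invTrace Γ' Φ (A • τ) = invTrace Γ' Φ τ := by
  classical
  haveI : Fintype (SL(2, ℤ) ⧸ Γ') := Fintype.ofFinite _
  rw [invTrace_eq_sum, invTrace_eq_sum]
  have h : ∀ q : SL(2, ℤ) ⧸ Γ', Φ ((Quotient.out q)⁻¹ • A • τ) =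
      Φ ((Quotient.out (A⁻¹ • q))⁻¹ • τ) := by
    intro q
    have hq : A⁻¹ • q = QuotientGroup.mk (A⁻¹ * Quotient.out q) := by
      conv_lhs => rw [← QuotientGroup.out_eq' q]
      rfl
    rw [hq, apply_out_inv_smul hΦ, mul_inv_rev, inv_inv, mul_smul]
  simp_rw [h]
  exact Fintype.sum_equiv (MulAction.toPerm (A⁻¹ : SL(2, ℤ))) _ _ fun q ↦ rfl

/-- `Φ ≤ invTrace Γ' Φ` (the identity coset) for `Φ ≥ 0` invariant. [folklore] -/
theorem le_invTrace (hΦ0 : ∀ τ, 0 ≤ Φ τ) (hΦ : ∀ γ ∈ Γ', ∀ τ : ℍ, Φ (γ • τ) = Φ τ) (τ : ℍ) :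
    Φ τ ≤ invTrace Γ' Φ τ := by
  classical
  haveI : Fintype (SL(2, ℤ) ⧸ Γ') := Fintype.ofFinite _
  rw [invTrace_eq_sum]
  have h1 : Φ τ = Φ ((Quotient.out (QuotientGroup.mk 1 : SL(2, ℤ) ⧸ Γ'))⁻¹ • τ) := by
    rw [apply_out_inv_smul hΦ, inv_one, one_smul]
  rw [h1]
  exact Finset.single_le_sum (f := fun q : SL(2, ℤ) ⧸ Γ' ↦ Φ ((Quotient.out q)⁻¹ • τ))
    (fun q _ ↦ hΦ0 _) (Finset.mem_univ _)

omit [Γ'.FiniteIndex] in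
/-- Continuity of `τ ↦ Φ(B τ)`. [folklore] -/
theorem continuous_comp_sl_smul (hΦc : Continuous Φ) (B : SL(2, ℤ)) :
    Continuous fun τ : ℍ ↦ Φ (B • τ) := by
  have e : ∀ τ : ℍ, B • τ = (Matrix.SpecialLinearGroup.mapGL ℝ B : GL (Fin 2) ℝ) • τ := fun τ ↦ rfl
  simp_rw [e]
  exact hΦc.comp (continuous_const_smul _)

/-- The trace of a continuous function is continuous. [folklore] -/
theorem continuous_invTrace (hΦc : Continuous Φ) : Continuous (invTrace Γ' Φ) := by
  classical
  haveI : Fintype (SL(2, ℤ) ⧸ Γ') := Fintype.ofFinite _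
  have h : invTrace Γ' Φ = fun τ ↦ ∑ q : SL(2, ℤ) ⧸ Γ', Φ ((Quotient.out q)⁻¹ • τ) :=
    funext fun τ ↦ invTrace_eq_sum Φ τ
  rw [h]
  exact continuous_finsetSum _ fun q _ ↦ continuous_comp_sl_smul hΦc _

/-- The trace of a function bounded by `B` is bounded by `[SL₂(ℤ) : Γ'] B`. [folklore] -/
theorem invTrace_le {B : ℝ} (hΦB : ∀ τ, Φ τ ≤ B) (τ : ℍ) :
    invTrace Γ' Φ τ ≤ Nat.card (SL(2, ℤ) ⧸ Γ') * B := by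
  classical
  haveI : Fintype (SL(2, ℤ) ⧸ Γ') := Fintype.ofFinite _
  rw [invTrace_eq_sum, Nat.card_eq_fintype_card]
  calc ∑ q : SL(2, ℤ) ⧸ Γ', Φ ((Quotient.out q)⁻¹ • τ) ≤ ∑ _q : SL(2, ℤ) ⧸ Γ', B :=
        Finset.sum_le_sum fun q _ ↦ hΦB _
    _ = Fintype.card (SL(2, ℤ) ⧸ Γ') * B := by
        rw [Finset.sum_const, Finset.card_univ, nsmul_eq_mul]

/-- `1`-periodicity of the trace along horocycles (`T ∈ SL₂(ℤ)`). [folklore] -/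
theorem periodic_invTrace_horizontal (hΦ : ∀ γ ∈ Γ', ∀ τ : ℍ, Φ (γ • τ) = Φ τ) {y : ℝ} (hy : 0 < y) :
    Function.Periodic (fun x : ℝ ↦ invTrace Γ' Φ (ofComplex ((x : ℂ) + y * I))) 1 := by
  intro x
  have him : 0 < ((x : ℂ) + y * I).im := by simpa using hy
  have him' : 0 < ((((x + 1 : ℝ) : ℂ)) + y * I).im := by simpa using hy
  dsimp only
  have hT : ofComplex ((((x + 1 : ℝ) : ℂ)) + y * I) = ModularGroup.T • ofComplex ((x : ℂ) + y * I) := by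
    rw [ofComplex_apply_of_im_pos him, ofComplex_apply_of_im_pos him']
    apply UpperHalfPlane.ext
    rw [UpperHalfPlane.modular_T_smul, coe_vadd]
    push_cast
    ring
  rw [hT, invTrace_smul hΦ]

/-- Continuity of the horocycle section of the trace. [folklore] -/
theorem continuous_invTrace_horizontal (hΦc : Continuous Φ) {y : ℝ} (hy : 0 < y) :
    Continuous fun x : ℝ ↦ invTrace Γ' Φ (ofComplex ((x : ℂ) + y * I)) := by
  have him : ∀ x : ℝ, 0 < ((x : ℂ) + y * I).im := fun x ↦ by simpa using hy
  have e : (fun x : ℝ ↦ invTrace Γ' Φ (ofComplex ((x : ℂ) + y * I))) =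
      fun x : ℝ ↦ invTrace Γ' Φ ⟨(x : ℂ) + y * I, him x⟩ := by
    funext x; rw [ofComplex_apply_of_im_pos (him x)]
  rw [e]
  exact (continuous_invTrace hΦc).comp (Continuous.upperHalfPlaneMk (by fun_prop) him)

end Trace

/-! ### 2. The scaling `D_t = diag(1, t)`, the conjugated group `Γ^{(t)}`, the density `Φ_t` -/

section Scaling

/-- The integer matrix `D_t = diag(1, t)`. [folklore] -/
def scaleMat (t : ℕ) : Matrix (Fin 2) (Fin 2) ℤ := !![1, 0; 0, (t : ℤ)]

/-- `D_t ∈ GL₂(ℚ)` (for Mathlib's `conjGL`/`IsCongruenceSubgroup.conjGL`). [folklore] -/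
def scaleGLRat (t : ℕ) [NeZero t] : GL (Fin 2) ℚ :=
  Matrix.GeneralLinearGroup.mkOfDetNeZero !![1, 0; 0, (t : ℚ)]
    (by simp [Matrix.det_fin_two, NeZero.ne t])

/-- `D_t = diag(1, t) ∈ GL₂(ℝ)`, acting on `ℍ` by `w ↦ w/t` (the tree's `intGL` of `scaleMat t`). [folklore] -/
def scaleGL (t : ℕ) : GL (Fin 2) ℝ := intGL (scaleMat t)

variable (t : ℕ)

/-- `det D_t = t`. [folklore] -/
theorem det_scaleMat : (scaleMat t).det = t := by
  simp [scaleMat, Matrix.det_fin_two]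

/-- `det D_t ≠ 0`. [folklore] -/
theorem det_scaleMat_ne_zero [NeZero t] : (scaleMat t).det ≠ 0 := by
  rw [det_scaleMat]; exact_mod_cast NeZero.ne t

/-- The `(0,0)` entry of `D_t` is `1`. [folklore] -/
@[simp] theorem scaleGL_apply_00 [NeZero t] : (scaleGL t) 0 0 = 1 := by
  rw [scaleGL, intGL_apply (det_scaleMat_ne_zero t)]; simp [scaleMat]
/-- The `(0,1)` entry of `D_t` is `0`. [folklore] -/
@[simp] theorem scaleGL_apply_01 [NeZero t] : (scaleGL t) 0 1 = 0 := by
  rw [scaleGL, intGL_apply (det_scaleMat_ne_zero t)]; simp [scaleMat]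
/-- The `(1,0)` entry of `D_t` is `0`. [folklore] -/
@[simp] theorem scaleGL_apply_10 [NeZero t] : (scaleGL t) 1 0 = 0 := by
  rw [scaleGL, intGL_apply (det_scaleMat_ne_zero t)]; simp [scaleMat]
/-- The `(1,1)` entry of `D_t` is `t`. [folklore] -/
@[simp] theorem scaleGL_apply_11 [NeZero t] : (scaleGL t) 1 1 = t := by
  rw [scaleGL, intGL_apply (det_scaleMat_ne_zero t)]; simp [scaleMat]

/-- `D_t` over `ℝ` is the image of `D_t` over `ℚ`. [folklore] -/
theorem scaleGL_eq_map_scaleGLRat [NeZero t] : scaleGL t = (scaleGLRat t).map (Rat.castHom ℝ) := by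
  refine Units.ext (Matrix.ext fun i j ↦ ?_)
  fin_cases i <;> fin_cases j <;>
    simp [scaleGLRat, Matrix.GeneralLinearGroup.mkOfDetNeZero]

/-- `det D_t = t > 0` in `GL₂(ℝ)`. [folklore] -/
theorem det_scaleGL [NeZero t] : (scaleGL t).det.val = t := by
  rw [Matrix.GeneralLinearGroup.val_det_apply, Matrix.det_fin_two]
  simp

/-- `0 < det D_t`. [folklore] -/
theorem det_scaleGL_pos [NeZero t] : 0 < (scaleGL t).det.val := by
  rw [det_scaleGL]; exact_mod_cast NeZero.pos t

/-- **`D_t • w = w/t`** (as complex numbers). [folklore] -/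
theorem coe_scaleGL_smul [NeZero t] (w : ℍ) : ((scaleGL t • w : ℍ) : ℂ) = (w : ℂ) / t := by
  rw [UpperHalfPlane.coe_smul_of_det_pos (det_scaleGL_pos t), UpperHalfPlane.num, UpperHalfPlane.denom]
  simp

/-- `Im(D_t • w) = Im w / t`. [folklore] -/
theorem im_scaleGL_smul [NeZero t] (w : ℍ) : (scaleGL t • w).im = w.im / t := by
  rw [← UpperHalfPlane.coe_im, coe_scaleGL_smul, Complex.div_natCast_im, UpperHalfPlane.coe_im]

variable (N : ℕ)

/-- **The conjugated group `Γ^{(t)} = SL₂(ℤ) ∩ D_t⁻¹ Γ₀(N) D_t`** (`= {γ : t ∣ b, N/t ∣ c}` for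
`t ∣ N`; Mathlib `conjGL`): the group making `w ↦ F(D_t w)` invariant for `Γ₀(N)`-invariant `F`.
[cite: Iwaniec2002, §2.4] -/
def levelConj : Subgroup SL(2, ℤ) := conjGL (Gamma0 N) (scaleGL t)

/-- `Γ^{(t)}` is a congruence subgroup, hence of finite index. [folklore] -/
instance finiteIndex_levelConj [NeZero t] [NeZero N] : (levelConj t N).FiniteIndex := by
  have h := ((Gamma0_is_congruence N).conjGL (scaleGLRat t)).finiteIndex
  rwa [← scaleGL_eq_map_scaleGLRat] at h

variable {t N}

/-- Membership: `γ ∈ Γ^{(t)}` iff `D_t γ D_t⁻¹ ∈ Γ₀(N)` (as real matrices). [folklore] -/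
theorem mem_levelConj_iff {γ : SL(2, ℤ)} :
    γ ∈ levelConj t N ↔ ∃ y ∈ Gamma0 N,
      (Matrix.SpecialLinearGroup.mapGL ℝ y : GL (Fin 2) ℝ) =
        scaleGL t * Matrix.SpecialLinearGroup.mapGL ℝ γ * (scaleGL t)⁻¹ :=
  mem_conjGL

/-- **The scaled Petersson density `Φ_t(w) = F_f(D_t w) = |f(w/t)|² (Im w/t)²`** (weight `2`).
[cite: Rankin1939, §4] -/
def scaledDensity (t : ℕ) (f : ℍ → ℂ) (w : ℍ) : ℝ := petDensity 2 f (scaleGL t • w)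

/-- `Φ_t ≥ 0`. [folklore] -/
theorem scaledDensity_nonneg (f : ℍ → ℂ) (w : ℍ) : 0 ≤ scaledDensity t f w := petDensity_nonneg 2 f _

/-- Continuity of `Φ_t` for continuous `f`. [folklore] -/
theorem continuous_scaledDensity {f : ℍ → ℂ} (hf : Continuous f) : Continuous (scaledDensity t f) := by
  unfold scaledDensity petDensity
  have h1 : Continuous fun w : ℍ ↦ scaleGL t • w := continuous_const_smul _
  refine ((continuous_norm.comp (hf.comp h1)).pow 2).mul ?_
  exact Continuous.zpow₀ (UpperHalfPlane.continuous_im.comp h1) 2 fun w ↦ Or.inl (im_pos _).ne'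

/-- **`Γ^{(t)}`-invariance of `Φ_t`**: for `γ ∈ Γ^{(t)}` with `D_tγD_t⁻¹ = y ∈ Γ₀(N)`,
`Φ_t(γw) = F_f(D_tγ w) = F_f(y D_t w) = F_f(D_t w) = Φ_t(w)`. [cite: Rankin1939, §4] -/
theorem scaledDensity_smul_of_mem {F : Type*} [FunLike F ℍ ℂ] [SlashInvariantFormClass F (Gamma0 N) 2]
    (f : F) {γ : SL(2, ℤ)} (hγ : γ ∈ levelConj t N) (w : ℍ) :
    scaledDensity t f (γ • w) = scaledDensity t f w := by
  obtain ⟨y, hy, hyeq⟩ := mem_levelConj_iff.mp hγ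
  unfold scaledDensity
  have e1 : scaleGL t • γ • w = (scaleGL t * Matrix.SpecialLinearGroup.mapGL ℝ γ) • w := by
    rw [mul_smul]; rfl
  have e2 : scaleGL t * Matrix.SpecialLinearGroup.mapGL ℝ γ =
      Matrix.SpecialLinearGroup.mapGL ℝ y * scaleGL t := by
    rw [hyeq, inv_mul_cancel_right]
  rw [e1, e2, mul_smul]
  exact petDensity_smul_of_mem 2 f hy _

/-! #### The integer matrices `D_t A` and the translates `f |₂ (D_t A)` -/

/-- The integer matrix `D_t A` (`A ∈ SL₂(ℤ)`), of determinant `t`. [folklore] -/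
def conjMat (t : ℕ) (A : SL(2, ℤ)) : Matrix (Fin 2) (Fin 2) ℤ := scaleMat t * (A : Matrix (Fin 2) (Fin 2) ℤ)

/-- `det(D_t A) = t`. [folklore] -/
theorem det_conjMat (A : SL(2, ℤ)) : (conjMat t A).det = t := by
  rw [conjMat, Matrix.det_mul, A.det_coe, mul_one, det_scaleMat]

/-- `0 < det(D_t A)`. [folklore] -/
theorem det_conjMat_pos [NeZero t] (A : SL(2, ℤ)) : 0 < (conjMat t A).det := by
  rw [det_conjMat]; exact_mod_cast NeZero.pos t

/-- `intGL (D_t A) = D_t · A` in `GL₂(ℝ)`. [folklore] -/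
theorem intGL_conjMat [NeZero t] (A : SL(2, ℤ)) :
    intGL (conjMat t A) = scaleGL t * Matrix.SpecialLinearGroup.mapGL ℝ A := by
  rw [conjMat, intGL_mul (det_scaleMat_ne_zero t) (by rw [A.det_coe]; exact one_ne_zero),
    mapGL_eq_intGL]
  rfl

/-- **`Φ_t(A w) = F_{f|(D_tA)}(w)`**: in weight `2` the Petersson density of a translate by
`g ∈ GL₂⁺(ℝ)` is the density at `g w` (Mathlib `petersson_slash`, `|det g|^{k−2} = 1`).
[folklore] -/
theorem petDensity_two_slash_of_det_pos (f : ℍ → ℂ) {g : GL (Fin 2) ℝ} (hg : 0 < g.det.val) (τ : ℍ) :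
    petDensity 2 (f ∣[(2 : ℤ)] g) τ = petDensity 2 f (g • τ) := by
  rw [petDensity_eq_norm_petersson, petDensity_eq_norm_petersson, UpperHalfPlane.petersson_slash,
    sub_self, zpow_zero, one_mul, σ_eq_self hg]

/-- `Φ_t(A w) = F_{f |₂ (D_t A)}(w)` for `A ∈ SL₂(ℤ)`. [folklore] -/
theorem scaledDensity_sl_smul [NeZero t] (f : ℍ → ℂ) (A : SL(2, ℤ)) (w : ℍ) :
    scaledDensity t f (A • w) = petDensity 2 (f ∣[(2 : ℤ)] intGL (conjMat t A)) w := by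
  rw [petDensity_two_slash_of_det_pos f (by rw [intGL_conjMat]; simpa using det_scaleGL_pos t),
    intGL_conjMat, mul_smul]
  rfl

/-- **The translates `f |₂ (D_t A)` of `f ∈ S₂(Γ₀(N))` are cuspidal `q`-series of period `Nt`**
(the tree's `isCuspFunction_slash_intGL`: an integer matrix of determinant `t`). [folklore] -/
theorem isCuspFunction_slash_conjMat [NeZero t] [NeZero N] (f : CuspForm (Gamma0 N) 2) (A : SL(2, ℤ)) :
    IsCuspFunction ((N * t : ℕ) : ℝ) (⇑f ∣[(2 : ℤ)] intGL (conjMat t A)) := by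
  have h := isCuspFunction_slash_intGL (n := 0) f (det_conjMat_pos (t := t) A)
  rw [det_conjMat] at h
  have e : ((N * t : ℕ) : ℝ) = (N : ℝ) * ((t : ℤ) : ℝ) := by push_cast; ring
  rw [e]
  exact h

end Scaling

/-! ### 3. The conjugated trace `G_f^{(t)}` and its horocycle coefficients -/

section ConjTrace

variable (N t : ℕ) [NeZero N] [NeZero t]

/-- **The conjugated trace `G_f^{(t)} = Σ_{A ∈ SL₂(ℤ)/Γ^{(t)}} Φ_t(A⁻¹ ·)`**, `Φ_t(w) = |f(w/t)|²(Im w/t)²`.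
[cite: Rankin1939, §4] -/
def conjTrace (f : ℍ → ℂ) : ℍ → ℝ := invTrace (levelConj t N) (scaledDensity t f)

/-- **The horocycle coefficients of `G_f^{(t)}`**: `Σ_{A ∈ SL₂(ℤ)/Γ^{(t)}} |cₙ(f |₂ (D_t A⁻¹))|²`
(period-`Nt` `q`-expansion coefficients of the translates). [cite: Rankin1939, §4 (4.2.3)] -/
def conjCoeff (f : ℍ → ℂ) (n : ℕ) : ℝ :=
  ∑ᶠ q : SL(2, ℤ) ⧸ levelConj t N,
    ‖(qExpansion ((N * t : ℕ) : ℝ) (f ∣[(2 : ℤ)] intGL (conjMat t (Quotient.out q)⁻¹))).coeff n‖ ^ 2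

variable {N t}

/-- `G_f^{(t)}(Aτ) = G_f^{(t)}(τ)` for all `A ∈ SL₂(ℤ)`. [cite: Rankin1939, §4] -/
theorem conjTrace_smul (f : CuspForm (Gamma0 N) 2) (A : SL(2, ℤ)) (τ : ℍ) :
    conjTrace N t f (A • τ) = conjTrace N t f τ :=
  invTrace_smul (fun _ hγ w ↦ scaledDensity_smul_of_mem f hγ w) A τ

omit [NeZero N] [NeZero t] in
/-- `G_f^{(t)} ≥ 0`. [folklore] -/
theorem conjTrace_nonneg (f : ℍ → ℂ) (τ : ℍ) : 0 ≤ conjTrace N t f τ :=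
  invTrace_nonneg (scaledDensity_nonneg (t := t) f) τ

/-- `G_f^{(t)}` is continuous. [folklore] -/
theorem continuous_conjTrace (f : CuspForm (Gamma0 N) 2) : Continuous (conjTrace N t f) :=
  continuous_invTrace (continuous_scaledDensity (ModularFormClass.continuous f))

/-- **`G_f^{(t)}` is bounded**: `Φ_t ≤ sup |f|²y²` (Mathlib `CuspFormClass.petersson_bounded_left`)
and the trace has finitely many terms. [folklore] -/
theorem exists_conjTrace_le (f : CuspForm (Gamma0 N) 2) :
    ∃ B : ℝ, 0 ≤ B ∧ ∀ τ : ℍ, conjTrace N t f τ ≤ B := by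
  obtain ⟨C, hC⟩ := CuspFormClass.petersson_bounded_left 2 (Gamma0 N : Subgroup (GL (Fin 2) ℝ)) f f
  have hC0 : 0 ≤ C := (norm_nonneg _).trans (hC UpperHalfPlane.I)
  refine ⟨Nat.card (SL(2, ℤ) ⧸ levelConj t N) * C, by positivity, fun τ ↦ invTrace_le (fun w ↦ ?_) τ⟩
  unfold scaledDensity
  rw [petDensity_eq_norm_petersson]
  exact hC _

omit [NeZero N] [NeZero t] in
/-- `conjCoeff` as a finite sum. [folklore] -/
theorem conjCoeff_eq_sum [Fintype (SL(2, ℤ) ⧸ levelConj t N)] (f : ℍ → ℂ) (n : ℕ) :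
    conjCoeff N t f n = ∑ q : SL(2, ℤ) ⧸ levelConj t N,
      ‖(qExpansion ((N * t : ℕ) : ℝ) (f ∣[(2 : ℤ)] intGL (conjMat t (Quotient.out q)⁻¹))).coeff n‖ ^ 2 := by
  unfold conjCoeff
  rw [finsum_eq_sum_of_fintype]

omit [NeZero N] [NeZero t] in
/-- `conjCoeff ≥ 0`. [folklore] -/
theorem conjCoeff_nonneg (f : ℍ → ℂ) (n : ℕ) : 0 ≤ conjCoeff N t f n :=
  finsum_nonneg fun _ ↦ sq_nonneg _

/-- `conjCoeff 0 = 0` (every translate is cuspidal). [folklore] -/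
theorem conjCoeff_zero (f : CuspForm (Gamma0 N) 2) : conjCoeff N t f 0 = 0 := by
  classical
  haveI : Fintype (SL(2, ℤ) ⧸ levelConj t N) := Fintype.ofFinite _
  rw [conjCoeff_eq_sum]
  refine Finset.sum_eq_zero fun q _ ↦ ?_
  rw [(isCuspFunction_slash_conjMat f _).coeff_zero, norm_zero, zero_pow two_ne_zero]

/-! #### The horocycle identity -/

/-- One translate: **`∫₀^{Nt} Φ_t(A(x + iy)) dx = y² · Nt Σₙ |cₙ(f |₂ D_tA)|² e^{−4πny/(Nt)}`**
(`Φ_t(A w) = |(f|D_tA)(w)|² y²` and Parseval for the period-`Nt` cusp function `f |₂ D_tA`).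
[cite: Rankin1939, §4 (4.2.3)] -/
theorem intervalIntegral_scaledDensity_smul_horizontal (f : CuspForm (Gamma0 N) 2) (A : SL(2, ℤ))
    {y : ℝ} (hy : 0 < y) :
    ∫ x in (0 : ℝ)..(N * t : ℕ), scaledDensity t f (A • ofComplex ((x : ℂ) + y * I)) =
      y ^ (2 : ℤ) * (((N * t : ℕ) : ℝ) *
        ∑' n : ℕ, ‖(qExpansion ((N * t : ℕ) : ℝ) ((⇑f) ∣[(2 : ℤ)] intGL (conjMat t A))).coeff n‖ ^ 2 *
          Real.exp (-(4 * Real.pi * n / (N * t : ℕ)) * y)) := by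
  have him : ∀ x : ℝ, 0 < ((x : ℂ) + y * I).im := fun x ↦ by simpa using hy
  have hA := isCuspFunction_slash_conjMat (t := t) f A
  have e : ∀ x : ℝ, scaledDensity t f (A • ofComplex ((x : ℂ) + y * I)) =
      y ^ (2 : ℤ) * ‖((⇑f) ∣[(2 : ℤ)] intGL (conjMat t A)) (ofComplex ((x : ℂ) + y * I))‖ ^ 2 := by
    intro x
    rw [scaledDensity_sl_smul, petDensity, ofComplex_apply_of_im_pos (him x), mul_comm]
    congr 2
    show ((x : ℂ) + y * I).im = y
    simp
  simp_rw [e]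
  rw [intervalIntegral.integral_const_mul, hA.integral_norm_sq_horizontal hy]

omit [NeZero N] [NeZero t] in
/-- Continuity of `x ↦ Φ_t(A(x + iy))`. [folklore] -/
theorem continuous_scaledDensity_smul_horizontal (f : CuspForm (Gamma0 N) 2) (A : SL(2, ℤ))
    {y : ℝ} (hy : 0 < y) :
    Continuous fun x : ℝ ↦ scaledDensity t f (A • ofComplex ((x : ℂ) + y * I)) := by
  have him : ∀ x : ℝ, 0 < ((x : ℂ) + y * I).im := fun x ↦ by simpa using hy
  have e : (fun x : ℝ ↦ scaledDensity t f (A • ofComplex ((x : ℂ) + y * I))) =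
      fun x : ℝ ↦ scaledDensity t f (A • ⟨(x : ℂ) + y * I, him x⟩) := by
    funext x; rw [ofComplex_apply_of_im_pos (him x)]
  rw [e]
  exact (continuous_comp_sl_smul (continuous_scaledDensity (ModularFormClass.continuous f)) A).comp
    (Continuous.upperHalfPlaneMk (by fun_prop) him)

/-- Summability of `Σₙ conjCoeff(n) e^{−4πny/(Nt)}` (`y > 0`). [folklore] -/
theorem summable_conjCoeff_mul_exp (f : CuspForm (Gamma0 N) 2) {y : ℝ} (hy : 0 < y) :
    Summable fun n : ℕ ↦ conjCoeff N t f n * Real.exp (-(4 * Real.pi * n / (N * t : ℕ)) * y) := by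
  classical
  haveI : Fintype (SL(2, ℤ) ⧸ levelConj t N) := Fintype.ofFinite _
  have e : (fun n : ℕ ↦ conjCoeff N t f n * Real.exp (-(4 * Real.pi * n / (N * t : ℕ)) * y)) =
      fun n ↦ ∑ q : SL(2, ℤ) ⧸ levelConj t N,
        ‖(qExpansion ((N * t : ℕ) : ℝ) ((⇑f) ∣[(2 : ℤ)] intGL (conjMat t (Quotient.out q)⁻¹))).coeff n‖ ^ 2 *
          Real.exp (-(4 * Real.pi * n / (N * t : ℕ)) * y) := by
    funext n; rw [conjCoeff_eq_sum, Finset.sum_mul]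
  rw [e]
  exact summable_sum fun q _ ↦ (isCuspFunction_slash_conjMat f _).summable_norm_sq_mul_exp hy

/-- **The horocycle identity for the conjugated trace**: for `f ∈ S₂(Γ₀(N))`, `t ≥ 1`, `y > 0`,
`∫₀¹ G_f^{(t)}(x + iy) dx = y² Σₙ conjCoeff(n) e^{−4πny/(Nt)}` (`1`-periodicity: `Nt ∫₀¹ = ∫₀^{Nt}`,
then translate by translate). [cite: Rankin1939, §4 (4.2.3)] -/
theorem intervalIntegral_conjTrace_horizontal (f : CuspForm (Gamma0 N) 2) {y : ℝ} (hy : 0 < y) :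
    ∫ x in (0 : ℝ)..1, conjTrace N t f (ofComplex ((x : ℂ) + y * I)) =
      y ^ (2 : ℤ) * ∑' n : ℕ, conjCoeff N t f n * Real.exp (-(4 * Real.pi * n / (N * t : ℕ)) * y) := by
  classical
  haveI : Fintype (SL(2, ℤ) ⧸ levelConj t N) := Fintype.ofFinite _
  have hNt0 : (0 : ℝ) < ((N * t : ℕ) : ℝ) := by exact_mod_cast Nat.mul_pos (NeZero.pos N) (NeZero.pos t)
  have hinv : ∀ γ ∈ levelConj t N, ∀ w : ℍ, scaledDensity t f (γ • w) = scaledDensity t f w :=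
    fun _ hγ w ↦ scaledDensity_smul_of_mem f hγ w
  -- `Nt ∫₀¹ = ∫₀^{Nt}`
  have hP := intervalIntegral_zero_nat_of_periodic (periodic_invTrace_horizontal hinv hy)
    (continuous_invTrace_horizontal (continuous_scaledDensity (ModularFormClass.continuous f)) hy) (N * t)
  rw [smul_eq_mul] at hP
  change ∫ x in (0 : ℝ)..(N * t : ℕ), conjTrace N t f (ofComplex ((x : ℂ) + y * I)) =
    ((N * t : ℕ) : ℝ) * ∫ x in (0 : ℝ)..1, conjTrace N t f (ofComplex ((x : ℂ) + y * I)) at hP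
  -- expand `∫₀^{Nt}` translate by translate
  have hsum : ∫ x in (0 : ℝ)..(N * t : ℕ), conjTrace N t f (ofComplex ((x : ℂ) + y * I)) =
      ∑ q : SL(2, ℤ) ⧸ levelConj t N,
        ∫ x in (0 : ℝ)..(N * t : ℕ), scaledDensity t f ((Quotient.out q)⁻¹ • ofComplex ((x : ℂ) + y * I)) := by
    rw [← intervalIntegral.integral_finsetSum]
    · exact intervalIntegral.integral_congr fun x _ ↦ invTrace_eq_sum _ _
    · intro q _
      exact (continuous_scaledDensity_smul_horizontal f _ hy).intervalIntegrable _ _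
  rw [hsum] at hP
  simp_rw [intervalIntegral_scaledDensity_smul_horizontal f _ hy] at hP
  rw [← Finset.mul_sum, ← Finset.mul_sum, ← Summable.tsum_finsetSum
    (fun q _ ↦ (isCuspFunction_slash_conjMat f _).summable_norm_sq_mul_exp hy)] at hP
  have e : (fun n : ℕ ↦ ∑ q : SL(2, ℤ) ⧸ levelConj t N,
      ‖(qExpansion ((N * t : ℕ) : ℝ) ((⇑f) ∣[(2 : ℤ)] intGL (conjMat t (Quotient.out q)⁻¹))).coeff n‖ ^ 2 *
        Real.exp (-(4 * Real.pi * n / (N * t : ℕ)) * y)) =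
      fun n ↦ conjCoeff N t f n * Real.exp (-(4 * Real.pi * n / (N * t : ℕ)) * y) := by
    funext n; rw [conjCoeff_eq_sum, Finset.sum_mul]
  rw [e] at hP
  -- cancel `Nt`
  have hP' : ((N * t : ℕ) : ℝ) * ∫ x in (0 : ℝ)..1, conjTrace N t f (ofComplex ((x : ℂ) + y * I)) =
      ((N * t : ℕ) : ℝ) * (y ^ (2 : ℤ) *
        ∑' n : ℕ, conjCoeff N t f n * Real.exp (-(4 * Real.pi * n / (N * t : ℕ)) * y)) := by
    rw [← hP]; ring
  exact mul_left_cancel₀ hNt0.ne' hP'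

/-- **Bound for the generating series**: `Σₙ conjCoeff(n) e^{−4πny/(Nt)} ≤ B y⁻²` (`y > 0`) when
`G_f^{(t)} ≤ B`. [folklore] -/
theorem tsum_conjCoeff_mul_exp_le (f : CuspForm (Gamma0 N) 2) {B : ℝ} (hB : ∀ τ : ℍ, conjTrace N t f τ ≤ B)
    {y : ℝ} (hy : 0 < y) :
    ∑' n : ℕ, conjCoeff N t f n * Real.exp (-(4 * Real.pi * n / (N * t : ℕ)) * y) ≤ B / y ^ (2 : ℤ) := by
  have hyk : 0 < y ^ (2 : ℤ) := zpow_pos hy 2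
  rw [le_div_iff₀ hyk, mul_comm, ← intervalIntegral_conjTrace_horizontal f hy]
  calc ∫ x in (0 : ℝ)..1, conjTrace N t f (ofComplex ((x : ℂ) + y * I))
      ≤ ∫ _x in (0 : ℝ)..1, B :=
        intervalIntegral.integral_mono_on zero_le_one
          ((continuous_invTrace_horizontal (continuous_scaledDensity (ModularFormClass.continuous f)) hy).intervalIntegrable _ _)
          (continuous_const.intervalIntegrable _ _) (fun x _ ↦ hB _)
    _ = B := by simp

/-! #### The horocycle datum, in the exact form of `RankinSelbergHorocycleMellin` -/

/-- **`(G_f^{(t)}, conjCoeff, a = 4π/(Nt), κ = 2)` is a horocycle datum**: for `f ∈ S₂(Γ₀(N))`,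
`t ≥ 1` and a bound `B` of `G_f^{(t)}` (`exists_conjTrace_le`), the hypotheses `hGc, hGinv, hG0, hGB,
hC, hC0, ha, hκ, hs, hle, hm` of `Literature.NumberTheory.Automorphic.J₀_eq_of_one_lt_re` /
`differentiable_J₀` hold with `G = conjTrace N t f`, `C = conjCoeff N t f`, `a = 4π/(Nt)`, `κ = 2`.
[cite: Rankin1939, §4] -/
theorem conjTrace_horocycle_datum (f : CuspForm (Gamma0 N) 2) {B : ℝ} (hB : ∀ τ : ℍ, conjTrace N t f τ ≤ B) :
    Continuous (conjTrace N t f) ∧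
    (∀ (A : SL(2, ℤ)) (τ : ℍ), conjTrace N t f (A • τ) = conjTrace N t f τ) ∧
    (∀ τ, 0 ≤ conjTrace N t f τ) ∧ (∀ τ, conjTrace N t f τ ≤ B) ∧
    (∀ n, 0 ≤ conjCoeff N t f n) ∧ conjCoeff N t f 0 = 0 ∧
    (0 < 4 * Real.pi / ((N * t : ℕ) : ℝ)) ∧ ((0 : ℝ) ≤ 2) ∧
    (∀ y : ℝ, 0 < y → Summable fun n : ℕ ↦
      conjCoeff N t f n * Real.exp (-(4 * Real.pi / ((N * t : ℕ) : ℝ)) * n * y)) ∧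
    (∀ y : ℝ, 0 < y → ∑' n : ℕ, conjCoeff N t f n * Real.exp (-(4 * Real.pi / ((N * t : ℕ) : ℝ)) * n * y)
      ≤ B * y ^ (-(2 : ℝ))) ∧
    (∀ y : ℝ, 0 < y → ∫ x in (0 : ℝ)..1, conjTrace N t f (pt x y) =
      y ^ (2 : ℝ) * ∑' n : ℕ, conjCoeff N t f n * Real.exp (-(4 * Real.pi / ((N * t : ℕ) : ℝ)) * n * y)) := by
  have hNt0 : (0 : ℝ) < ((N * t : ℕ) : ℝ) := by exact_mod_cast Nat.mul_pos (NeZero.pos N) (NeZero.pos t)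
  have hexp : ∀ (n : ℕ) (y : ℝ), Real.exp (-(4 * Real.pi / ((N * t : ℕ) : ℝ)) * n * y) =
      Real.exp (-(4 * Real.pi * n / (N * t : ℕ)) * y) := by
    intro n y; congr 1; ring
  refine ⟨continuous_conjTrace f, conjTrace_smul f, conjTrace_nonneg f, hB, conjCoeff_nonneg f,
    conjCoeff_zero f, by positivity, by norm_num, fun y hy ↦ ?_, fun y hy ↦ ?_, fun y hy ↦ ?_⟩
  · simp_rw [hexp]; exact summable_conjCoeff_mul_exp f hy
  · simp_rw [hexp]
    rw [Real.rpow_neg hy.le, show ((2 : ℝ)) = ((2 : ℤ) : ℝ) by norm_num, Real.rpow_intCast,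
      ← div_eq_mul_inv]
    exact tsum_conjCoeff_mul_exp_le f hB hy
  · simp_rw [hexp]
    have hpt : ∀ x : ℝ, pt x y = ofComplex ((x : ℂ) + y * I) := by
      intro x; unfold pt; congr 1; apply Complex.ext <;> simp
    simp_rw [hpt]
    rw [intervalIntegral_conjTrace_horizontal f hy, show ((2 : ℝ)) = ((2 : ℤ) : ℝ) by norm_num,
      Real.rpow_intCast]

end ConjTrace

end Literature.NumberTheory.EllipticCurves.ModularForms

end
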